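import Summits.QuantumFields.BalabanUV.T4Continuum.Support.SubstrateTransporterSpecies
import Mathlib.Analysis.SpecialFunctions.Exponential
import Mathlib.Analysis.Calculus.FDeriv.Mul
import Mathlib.Analysis.Calculus.FDeriv.Prod
import Mathlib.Analysis.Calculus.FDeriv.Equiv
import Mathlib.Topology.Algebra.Module.FiniteDimension

/-!
# SUBSTRATE — HOLOMORPHY OF THE TWO-SIDED COVARIANCE SPECIES ALONG THE EXPONENTIAL CHART: the regular set
# `{A | ΔQ(e^{A}R⁰, (R⁰)⁻¹e^{−A}) invertible at every level}` is OPEN, contains the centre `A = 0` when the background is regular, and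
# every entry of `unitCovT ∕ covAtT` is ℂ-differentiable on it — [dict] D-8 (4) «S-HOLO-AN» (MAP v0.5 §O1 D-8; follower of p220490)

Cell `pub-balaban`, SUBSTRATE cell, seat `b2b-balaban-substrate-p1` (gen 2).  Summits-side under the LEAN PLACEMENT RULE.  HONEST FRAMING:
rung (B)+1 of the FINITE-VOLUME T⁴ programme — NOT infinite volume, NOT a mass gap, NOT Clay; spine PROVED 0∕9; NE9 NOT proved.  CALCULUS
ONLY (identification-layer glue, row-agnostic, NO estimate): the two-sided species of `SubstrateTransporterSpecies` (`transport`, `covDc`,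
`covLapT`, `Qcov`, `QcovA`, `deltaQT`, `greenT`, `unitCovT`) are polynomial in the data `(R, S)` but for the ONE Green inverse, the chart
`A ↦ (expChart R⁰ A, expChartInv R⁰ A)` is entire, so the species read along the chart are holomorphic OFF the singular set of `deltaQT`, in
Mathlib's sense `DifferentiableOn ℂ` — the notion NE9's `NE9Lemma1RemainderSpecies.analyticClass` is made of.  No radius is computed: the
regular set is shown OPEN and to contain `0` under the DISPLAYED invertibility at the centre (discharged at regular backgrounds on the J-road,
`CovariantVectorGreenOfField.isUnit_det_deltaQOf_of_regular`; quantitative ball = VECJ-H).  Printed warrant for the READING (KIND only,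
nothing asserted): [Balaban1985BackgroundPropagators] p. 393 «extend … to configurations with values in the complexified group Gᶜ», Sect. B
pp. 399–400 «U′ = e^{iηA}U», Thm 3.4; [Balaban1987RG1] (1.18) p. 263 «defined and analytic on the space U^c_j(X, α₀, α₁)».  NORM OF RECORD
(typer ruling Q-S13): the chart space `TowerData P o` carries the Pi-sup norm over Mathlib's scoped `Matrix.Norms.L2Operator` instances;
consumers open the same scope.  HONEST DEPENDENCY (cell line, verbatim): continuum YM on T⁴ ⇐ BetaPertH ∧ nine spine estimates (0/9
proved); BetaPertH ⇐ (D1) ∧ (D4) ∧ CAP+tail; G-an2-4 gates asym, D1 and NE2/3/4.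

WHAT.  §1 entrywise calculus for matrix-valued maps in the `L2Operator` scope: `entryCLE`, **`differentiableOn_matrix_iff`**,
`differentiableOn_matrix_mul` (any shapes) ∕ `differentiableOn_matrix_inv` (on `{IsUnit det}`, via `Ring.inverse`).
§2 the one-level species along differentiable data `x ↦ (R x, S x)`: `differentiableOn_transport ∕ _transportA ∕ _siteMul ∕ _covDc ∕ _covDcA ∕
_covLapT ∕ _Qcov ∕ _QcovA ∕ _deltaQT`, and `differentiableOn_greenT ∕ _unitCovT` under `∀ x ∈ s, IsUnit (deltaQT …).det`.  §3 the chart is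
entire: `differentiable_mexp ∕ _expChart ∕ _expChartInv`.  §4 the TOWER chart `expChartT R⁰ A k := expChart (R⁰ k) (A k)` ∕ `expChartInvT`,
the REGULAR SET `regularSet P c a Γ R⁰ := ⋂ₖ {A | IsUnit (deltaQT … (expChartT R⁰ A k) (expChartInvT R⁰ A k)).det}`, **`isOpen_regularSet`**,
`zero_mem_regularSet_of_isUnit ∕ _of_unitary ∕ _towerDataOf` (centre = a regular background), `exists_ball_subset_regularSet`.  §5 HOLOMORPHY
OF RECORD: `differentiableOn_unitCovT_expChartT`, **`differentiableOn_covAtT_expChart`** (every level ∕ slot ∕ entry, on the regular set),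
`exists_ball_differentiableOn_covAtT` (the ball `analyticClass` asks for; radius NOT computed), and THE CENTRE READS THE RECORD:
`covAtOfRecord_eq_covAtT_expChartT_zero` (the `hE` of `NE9ChartFamilyPullback`).  Imports p220490 + Mathlib calculus; modifies nothing.
-/

noncomputable section

open scoped BigOperators Matrix Kronecker ComplexConjugate Matrix.Norms.L2Operator

namespace Summit.QuantumFields.BalabanUV.T4Continuum.SubstrateTransporterSpeciesHolo

open Literature.MathematicalPhysics.QuantumFieldTheory.Balaban1983to89
open Literature.MathematicalPhysics.QuantumFieldTheory.Balaban1983to89.B5Prop11Plancherel (Tor fine)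
open Literature.MathematicalPhysics.QuantumFieldTheory.Balaban1983to89.B5G183RateUnitTower (lev lev_neZero)
open Summit.QuantumFields.BalabanUV.T4Continuum.BlockMultiplication (siteMul siteMul_apply)
open Summit.QuantumFields.BalabanUV.T4Continuum.ColourCovariantLaplacian (covDc)
open Summit.QuantumFields.BalabanUV.T4Continuum.CovariantBlockAveraging (transport ContourSystem Qcov)
open Summit.QuantumFields.BalabanUV.T4Continuum.SubstrateBackgroundTransporters
open Summit.QuantumFields.BalabanUV.T4Continuum.SubstrateCovariantAveraging (deltaQOf)
open Summit.QuantumFields.BalabanUV.T4Continuum.SubstrateTransporterSpecies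

/-! ## §1 Entrywise calculus for matrix-valued maps (scope `Matrix.Norms.L2Operator`) -/

section Entry

variable {E : Type*} [NormedAddCommGroup E] [NormedSpace ℂ E] {l m n : Type*} [Fintype l] [Fintype m] [Fintype n]
  [DecidableEq m] [DecidableEq n]

omit [DecidableEq m] [DecidableEq n] in
/-- [folklore] The entry coordinates of a complex matrix as a continuous linear equivalence with the Pi space (finite dimension). -/
def entryCLE : Matrix m n ℂ ≃L[ℂ] (m → n → ℂ) :=
  ((Matrix.ofLinearEquiv ℂ).symm : Matrix m n ℂ ≃ₗ[ℂ] (m → n → ℂ)).toContinuousLinearEquiv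

omit [DecidableEq m] in
/-- [folklore] **A MATRIX-VALUED MAP IS ℂ-DIFFERENTIABLE ON A SET IFF EVERY ENTRY IS** (here in the scoped `L2Operator` norm). -/
theorem differentiableOn_matrix_iff {F : E → Matrix m n ℂ} {s : Set E} :
    DifferentiableOn ℂ F s ↔ ∀ i j, DifferentiableOn ℂ (fun x => F x i j) s := by
  rw [← (entryCLE (m := m) (n := n)).comp_differentiableOn_iff, differentiableOn_pi]
  refine forall_congr' fun i => ?_
  rw [differentiableOn_pi]
  rfl

/-- [folklore] **PRODUCTS OF DIFFERENTIABLE MATRIX MAPS ARE DIFFERENTIABLE** — any (rectangular) shapes (entries: finite sums of products). -/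
theorem differentiableOn_matrix_mul {F : E → Matrix l m ℂ} {G : E → Matrix m n ℂ} {s : Set E}
    (hF : DifferentiableOn ℂ F s) (hG : DifferentiableOn ℂ G s) : DifferentiableOn ℂ (fun x => F x * G x) s := by
  rw [differentiableOn_matrix_iff] at hF hG ⊢
  intro i j
  simp only [Matrix.mul_apply]
  exact DifferentiableOn.fun_sum fun k _ => (hF i k).fun_mul (hG k j)

/-- [folklore] **THE INVERSE OF A DIFFERENTIABLE SQUARE-MATRIX MAP IS DIFFERENTIABLE WHERE THE DETERMINANT IS A UNIT** (`M⁻¹ = Ring.inverse M`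
on matrices; `Ring.inverse` is differentiable at units of the complete normed algebra `Matrix n n ℂ`). -/
theorem differentiableOn_matrix_inv {F : E → Matrix n n ℂ} {s : Set E} (hF : DifferentiableOn ℂ F s)
    (h : ∀ x ∈ s, IsUnit (F x).det) : DifferentiableOn ℂ (fun x => (F x)⁻¹) s := by
  simp only [Matrix.nonsing_inv_eq_ringInverse]
  exact hF.inverse fun x hx => (Matrix.isUnit_iff_isUnit_det _).mpr (h x hx)

end Entry

/-! ## §2 The one-level two-sided species along differentiable transporter data -/

section OneLevel

variable {E : Type*} [NormedAddCommGroup E] [NormedSpace ℂ E] {s : Set E} {d : ℕ} (Nf : Fin d → ℕ) [hNf : ∀ μ, NeZero (Nf μ)]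
  {o : Type*} [Fintype o] [DecidableEq o] {R S : E → Fin d → (Tor Nf × Fin d → Matrix o o ℂ)}

omit hNf in
/-- [folklore] Parallel transport along a bond list is differentiable in the transporter data (a finite product of coordinates). -/
theorem differentiableOn_transport (hR : ∀ ν i, DifferentiableOn ℂ (fun x => R x ν i) s) (μ : Fin d) (Γ : List (Tor Nf × Fin d)) :
    DifferentiableOn ℂ (fun x => transport Nf (R x) μ Γ) s := by
  induction Γ with
  | nil => simp only [transport, List.map_nil, List.prod_nil]; exact differentiableOn_const _
  | cons b Γ ih =>
      simp only [transport, List.map_cons, List.prod_cons] at ih ⊢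
      exact (hR b.2 (b.1, μ)).fun_mul ih

omit hNf in
/-- [folklore] The adjoint (reversed) transport is differentiable in the second variable `S`. -/
theorem differentiableOn_transportA (hS : ∀ ν i, DifferentiableOn ℂ (fun x => S x ν i) s) (μ : Fin d) (Γ : List (Tor Nf × Fin d)) :
    DifferentiableOn ℂ (fun x => transportA Nf (S x) μ Γ) s := by
  induction Γ with
  | nil => simp only [transportA_nil]; exact differentiableOn_const _
  | cons b Γ ih =>
      have h : ∀ x, transportA Nf (S x) μ (b :: Γ) = transportA Nf (S x) μ Γ * S x b.2 (b.1, μ) := fun x => by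
        rw [← List.singleton_append, transportA_append]; simp [transportA]
      simp only [h]
      exact ih.fun_mul (hS b.2 (b.1, μ))

/-- [folklore] Site-wise colour multiplication is differentiable in its (differentiable) colour matrices. -/
theorem differentiableOn_siteMul {ι : Type*} [Fintype ι] [DecidableEq ι] {w : E → ι → Matrix o o ℂ}
    (hw : ∀ i, DifferentiableOn ℂ (fun x => w x i) s) : DifferentiableOn ℂ (fun x => siteMul (w x)) s := by
  rw [differentiableOn_matrix_iff]
  intro a b
  simp only [siteMul_apply]
  split_ifs
  · exact differentiableOn_matrix_iff.1 (hw a.1) a.2 b.2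
  · exact differentiableOn_const _

/-- [folklore] The covariant difference `covDc c R ν` is differentiable along differentiable transporters (affine in `R ν`). -/
theorem differentiableOn_covDc (hR : ∀ ν i, DifferentiableOn ℂ (fun x => R x ν i) s) (c : ℂ) (ν : Fin d) :
    DifferentiableOn ℂ (fun x => covDc Nf c (R x) ν) s := by
  unfold covDc
  exact (((differentiableOn_siteMul (hR ν)).mul_const _).sub_const _).fun_const_smul c

/-- [folklore] The adjoint covariant difference `covDcA c S ν` is differentiable along differentiable `S` (affine in `S ν`). -/
theorem differentiableOn_covDcA (hS : ∀ ν i, DifferentiableOn ℂ (fun x => S x ν i) s) (c : ℂ) (ν : Fin d) :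
    DifferentiableOn ℂ (fun x => covDcA Nf c (S x) ν) s := by
  unfold covDcA
  exact (((differentiableOn_siteMul (hS ν)).const_mul _).sub_const _).fun_const_smul (conj c)

/-- [folklore] The two-sided covariant Laplacian `covLapT c R S` is differentiable along differentiable `(R, S)` (bilinear). -/
theorem differentiableOn_covLapT (hR : ∀ ν i, DifferentiableOn ℂ (fun x => R x ν i) s)
    (hS : ∀ ν i, DifferentiableOn ℂ (fun x => S x ν i) s) (c : ℂ) : DifferentiableOn ℂ (fun x => covLapT Nf c (R x) (S x)) s := by
  unfold covLapT
  exact DifferentiableOn.fun_sum fun ν _ => (differentiableOn_covDcA Nf hS c ν).fun_mul (differentiableOn_covDc Nf hR c ν)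

end OneLevel

section Block

variable {E : Type*} [NormedAddCommGroup E] [NormedSpace ℂ E] {s : Set E} {d : ℕ} (n : ℕ) [NeZero n] (M : Fin d → ℕ)
  [hM : ∀ μ, NeZero (M μ)] {o : Type*} [Fintype o] [DecidableEq o] {R S : E → Fin d → (Tor (fine n M) × Fin d → Matrix o o ℂ)}

/-- [folklore] The covariant block averaging `Qcov Γ R` is differentiable along differentiable transporters (entries = weighted transports). -/
theorem differentiableOn_Qcov (hR : ∀ ν i, DifferentiableOn ℂ (fun x => R x ν i) s) (Γ : ContourSystem d n M) :
    DifferentiableOn ℂ (fun x => Qcov n M Γ (R x)) s := by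
  rw [differentiableOn_matrix_iff]
  intro b i
  simp only [Qcov]
  split_ifs
  · refine DifferentiableOn.fun_sum fun j _ => DifferentiableOn.fun_sum fun t _ => ?_
    split_ifs
    · exact (differentiableOn_matrix_iff.1 (differentiableOn_transport (fine n M) hR b.1.2 (Γ b.1.1 j b.1.2 t)) b.2 i.2).const_mul _
    · exact differentiableOn_const _
  · exact differentiableOn_const _

/-- [folklore] The adjoint block averaging `QcovA Γ S` is differentiable along differentiable `S`. -/
theorem differentiableOn_QcovA (hS : ∀ ν i, DifferentiableOn ℂ (fun x => S x ν i) s) (Γ : ContourSystem d n M) :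
    DifferentiableOn ℂ (fun x => QcovA n M Γ (S x)) s := by
  rw [differentiableOn_matrix_iff]
  intro i b
  simp only [QcovA]
  split_ifs
  · refine DifferentiableOn.fun_sum fun j _ => DifferentiableOn.fun_sum fun t _ => ?_
    split_ifs
    · exact (differentiableOn_matrix_iff.1 (differentiableOn_transportA (fine n M) hS b.1.2 (Γ b.1.1 j b.1.2 t)) i.2 b.2).const_mul _
    · exact differentiableOn_const _
  · exact differentiableOn_const _

/-- [folklore] **THE TWO-SIDED FLUCTUATION OPERATOR `deltaQT c a Γ R S` IS DIFFERENTIABLE ALONG DIFFERENTIABLE DATA `(R, S)`** (polynomial). -/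
theorem differentiableOn_deltaQT (hR : ∀ ν i, DifferentiableOn ℂ (fun x => R x ν i) s) (hS : ∀ ν i, DifferentiableOn ℂ (fun x => S x ν i) s)
    (c : ℂ) (a : ℝ) (Γ : ContourSystem d n M) : DifferentiableOn ℂ (fun x => deltaQT n M c a Γ (R x) (S x)) s := by
  unfold deltaQT
  exact (differentiableOn_covLapT (fine n M) hR hS c).fun_add
    ((differentiableOn_matrix_mul (differentiableOn_QcovA n M hS Γ) (differentiableOn_Qcov n M hR Γ)).fun_const_smul (a : ℂ))

/-- [folklore] **THE TWO-SIDED GREEN'S FUNCTION IS DIFFERENTIABLE OFF THE SINGULAR SET**: along differentiable `(R, S)`, on any set where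
`det (deltaQT …)` is a unit, `x ↦ greenT c a Γ (R x) (S x)` is ℂ-differentiable (the only non-polynomial step: `Ring.inverse`). -/
theorem differentiableOn_greenT (hR : ∀ ν i, DifferentiableOn ℂ (fun x => R x ν i) s) (hS : ∀ ν i, DifferentiableOn ℂ (fun x => S x ν i) s)
    {c : ℂ} {a : ℝ} {Γ : ContourSystem d n M} (hdet : ∀ x ∈ s, IsUnit (deltaQT n M c a Γ (R x) (S x)).det) :
    DifferentiableOn ℂ (fun x => greenT n M c a Γ (R x) (S x)) s := by
  unfold greenT
  exact differentiableOn_matrix_inv (differentiableOn_deltaQT n M hR hS c a Γ) hdet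

/-- [folklore] **THE TWO-SIDED UNIT-LATTICE COVARIANCE `unitCovT` IS DIFFERENTIABLE OFF THE SINGULAR SET OF `deltaQT`.** -/
theorem differentiableOn_unitCovT (hR : ∀ ν i, DifferentiableOn ℂ (fun x => R x ν i) s) (hS : ∀ ν i, DifferentiableOn ℂ (fun x => S x ν i) s)
    {c : ℂ} {a : ℝ} {Γ : ContourSystem d n M} (hdet : ∀ x ∈ s, IsUnit (deltaQT n M c a Γ (R x) (S x)).det) (sc : ℂ) :
    DifferentiableOn ℂ (fun x => unitCovT n M c a sc Γ (R x) (S x)) s := by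
  unfold unitCovT
  exact (differentiableOn_matrix_mul (differentiableOn_matrix_mul (differentiableOn_Qcov n M hR Γ)
    (differentiableOn_greenT n M hR hS hdet)) (differentiableOn_QcovA n M hS Γ)).fun_const_smul sc

end Block

/-! ## §3 The exponential chart is entire -/

section Chart

variable {d : ℕ} {o : Type*} [Fintype o] [DecidableEq o] {ι : Type*} [Fintype ι]

/-- [folklore] The matrix exponential is ℂ-differentiable everywhere (`NormedSpace.exp_analytic` on the complete normed algebra `Matrix o o ℂ`). -/
theorem differentiable_mexp : Differentiable ℂ (fun A : Matrix o o ℂ => NormedSpace.exp A) :=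
  fun A => (NormedSpace.exp_analytic (𝕂 := ℂ) A).differentiableAt

/-- [folklore] A bond coordinate `A ↦ A ν i` of one-level chart data is ℂ-differentiable (a continuous linear projection). -/
theorem differentiable_coord (ν : Fin d) (i : ι) : Differentiable ℂ (fun A : Fin d → ι → Matrix o o ℂ => A ν i) :=
  differentiable_pi.1 (differentiable_apply (𝕜 := ℂ) ν) i

/-- [folklore] **THE EXPONENTIAL CHART IS ENTIRE**: every bond transporter `A ↦ expChart R⁰ A ν i = exp (A ν i) · R⁰ ν i` is
ℂ-differentiable on the whole chart space. -/
theorem differentiable_expChart (R₀ : Fin d → ι → Matrix o o ℂ) (ν : Fin d) (i : ι) :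
    Differentiable ℂ (fun A : Fin d → ι → Matrix o o ℂ => expChart R₀ A ν i) := by
  simp only [expChart_apply]
  exact (differentiable_mexp.fun_comp (differentiable_coord ν i)).mul_const _

/-- [folklore] … and so is the inverse-side chart `A ↦ expChartInv R⁰ A ν i = (R⁰ ν i)⁻¹ · exp (−A ν i)` (no variable is inverted). -/
theorem differentiable_expChartInv (R₀ : Fin d → ι → Matrix o o ℂ) (ν : Fin d) (i : ι) :
    Differentiable ℂ (fun A : Fin d → ι → Matrix o o ℂ => expChartInv R₀ A ν i) := by
  simp only [expChartInv_apply]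
  exact (differentiable_mexp.fun_comp (differentiable_coord ν i).fun_neg).const_mul _

end Chart

/-! ## §4 The tower chart, the regular set, its openness and its centre -/

section Tower

variable (P : Params) {o : Type*} [Fintype o] [DecidableEq o]

/-- [folklore] **THE TOWER CHART**: the exponential chart applied level by level, `expChartT R⁰ A k := expChart (R⁰ k) (A k)` — the map
`A ↦ R` of [dict] D-8 (iii) on the chart space `TowerData P o` (centre `A = 0 ↦ R⁰`). -/
def expChartT (R₀ A : TowerData P o) : TowerData P o := fun k => expChart (R₀ k) (A k)

/-- [folklore] **THE INVERSE-SIDE TOWER CHART** `expChartInvT R⁰ A k := expChartInv (R⁰ k) (A k)` — the map `A ↦ S`. -/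
def expChartInvT (R₀ A : TowerData P o) : TowerData P o := fun k => expChartInv (R₀ k) (A k)

/-- [folklore] `expChartT` unfolds. -/
@[simp] theorem expChartT_apply (R₀ A : TowerData P o) (k : Fin (P.K + 1)) : expChartT P R₀ A k = expChart (R₀ k) (A k) := rfl

/-- [folklore] `expChartInvT` unfolds. -/
@[simp] theorem expChartInvT_apply (R₀ A : TowerData P o) (k : Fin (P.K + 1)) : expChartInvT P R₀ A k = expChartInv (R₀ k) (A k) := rfl

/-- [folklore] The tower chart is centred at `R⁰`. -/
theorem expChartT_zero (R₀ : TowerData P o) : expChartT P R₀ 0 = R₀ := by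
  funext k; rw [expChartT_apply, Pi.zero_apply, expChart_zero]

/-- [folklore] The inverse-side tower chart at the centre is the pointwise inverse of `R⁰`. -/
theorem expChartInvT_zero (R₀ : TowerData P o) : expChartInvT P R₀ 0 = fun k ν i => (R₀ k ν i)⁻¹ := by
  funext k; rw [expChartInvT_apply, Pi.zero_apply, expChartInv_zero]

/-- [folklore] Every bond transporter of the tower chart is ℂ-differentiable on `TowerData P o`. -/
theorem differentiable_expChartT_apply (R₀ : TowerData P o) (k : Fin (P.K + 1)) (ν : Fin P.d)
    (i : Tor (fine (lev P.L k) (unitMod P)) × Fin P.d) : Differentiable ℂ (fun A : TowerData P o => expChartT P R₀ A k ν i) :=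
  (differentiable_expChart (R₀ k) ν i).fun_comp (differentiable_apply (𝕜 := ℂ) k)

/-- [folklore] Every bond matrix of the inverse-side tower chart is ℂ-differentiable on `TowerData P o`. -/
theorem differentiable_expChartInvT_apply (R₀ : TowerData P o) (k : Fin (P.K + 1)) (ν : Fin P.d)
    (i : Tor (fine (lev P.L k) (unitMod P)) × Fin P.d) : Differentiable ℂ (fun A : TowerData P o => expChartInvT P R₀ A k ν i) :=
  (differentiable_expChartInv (R₀ k) ν i).fun_comp (differentiable_apply (𝕜 := ℂ) k)

variable (c : ℂ) (a : ℝ) (Γ : (k : ℕ) → ContourSystem P.d (lev P.L k) (unitMod P))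

/-- [folklore] **THE LEVEL-`k` REGULAR SET** of the chart at `R⁰`: the chart points at which the level-`k` two-sided fluctuation operator is
invertible (its determinant a unit) — the complement of the singular set of `greenT` at that level. -/
def regularSetAt (R₀ : TowerData P o) (k : Fin (P.K + 1)) : Set (TowerData P o) :=
  {A | IsUnit (deltaQT (lev P.L k) (unitMod P) c a (Γ k) (expChartT P R₀ A k) (expChartInvT P R₀ A k)).det}

/-- [folklore] **THE REGULAR SET** of the chart at `R⁰`: regular at every NE2 level `k ≤ K` (a finite intersection). -/
def regularSet (R₀ : TowerData P o) : Set (TowerData P o) := ⋂ k, regularSetAt P c a Γ R₀ k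

/-- [folklore] Membership in the regular set, unfolded. -/
theorem mem_regularSet_iff (R₀ A : TowerData P o) : A ∈ regularSet P c a Γ R₀ ↔ ∀ k, A ∈ regularSetAt P c a Γ R₀ k := Set.mem_iInter

/-- [folklore] The level-`k` fluctuation operator along the tower chart is ℂ-differentiable on the whole chart space (polynomial ∘ exp). -/
theorem differentiable_deltaQT_expChartT (R₀ : TowerData P o) (k : Fin (P.K + 1)) : Differentiable ℂ fun A : TowerData P o =>
    deltaQT (lev P.L k) (unitMod P) c a (Γ k) (expChartT P R₀ A k) (expChartInvT P R₀ A k) :=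
  differentiableOn_univ.1 <| differentiableOn_deltaQT (lev P.L k) (unitMod P)
    (fun ν i => (differentiable_expChartT_apply P R₀ k ν i).differentiableOn)
    (fun ν i => (differentiable_expChartInvT_apply P R₀ k ν i).differentiableOn) c a (Γ k)

/-- [folklore] … hence its determinant is continuous on the chart space. -/
theorem continuous_det_deltaQT_expChartT (R₀ : TowerData P o) (k : Fin (P.K + 1)) : Continuous fun A : TowerData P o =>
    (deltaQT (lev P.L k) (unitMod P) c a (Γ k) (expChartT P R₀ A k) (expChartInvT P R₀ A k)).det :=
  (differentiable_deltaQT_expChartT P c a Γ R₀ k).continuous.matrix_det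

/-- [folklore] **EACH LEVEL'S REGULAR SET IS OPEN** (preimage of `ℂ ∖ {0}` under a continuous determinant). -/
theorem isOpen_regularSetAt (R₀ : TowerData P o) (k : Fin (P.K + 1)) : IsOpen (regularSetAt P c a Γ R₀ k) := by
  simp only [regularSetAt, isUnit_iff_ne_zero]
  exact isOpen_ne_fun (continuous_det_deltaQT_expChartT P c a Γ R₀ k) continuous_const

/-- [folklore] **THE REGULAR SET IS OPEN** — so a regular centre carries a whole chart ball of regular points (`exists_ball_subset_regularSet`). -/
theorem isOpen_regularSet (R₀ : TowerData P o) : IsOpen (regularSet P c a Γ R₀) :=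
  isOpen_iInter_of_finite fun k => isOpen_regularSetAt P c a Γ R₀ k

/-- [folklore] The centre `A = 0` is level-`k` regular iff the level-`k` operator at `(R⁰ k, (R⁰ k)⁻¹)` is invertible. -/
theorem zero_mem_regularSetAt_iff (R₀ : TowerData P o) (k : Fin (P.K + 1)) : (0 : TowerData P o) ∈ regularSetAt P c a Γ R₀ k ↔
    IsUnit (deltaQT (lev P.L k) (unitMod P) c a (Γ k) (R₀ k) (fun ν i => (R₀ k ν i)⁻¹)).det := by
  simp only [regularSetAt, Set.mem_setOf_eq, expChartT_apply, expChartInvT_apply, Pi.zero_apply, expChart_zero, expChartInv_zero]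

/-- [folklore] **THE CENTRE IS REGULAR WHEN THE BACKGROUND IS**: if at every level the operator at `(R⁰ k, (R⁰ k)⁻¹)` is invertible
(DISPLAYED — NE2's gap at a regular background, J-road), then `0 ∈ regularSet`. -/
theorem zero_mem_regularSet_of_isUnit (R₀ : TowerData P o)
    (h : ∀ k : Fin (P.K + 1), IsUnit (deltaQT (lev P.L k) (unitMod P) c a (Γ k) (R₀ k) (fun ν i => (R₀ k ν i)⁻¹)).det) :
    (0 : TowerData P o) ∈ regularSet P c a Γ R₀ :=
  Set.mem_iInter.2 fun k => (zero_mem_regularSetAt_iff P c a Γ R₀ k).2 (h k)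

/-- [folklore] The same for UNITARY tower data, with the hypothesis read on the real slice `S = adjOf R⁰` (`adjOf_eq_inv`): invertibility
of `deltaQT … (R⁰ k) (adjOf (R⁰ k)) = covLapC + a·QᴴQ` (`deltaQT_adjOf`) at every level puts the centre in the regular set. -/
theorem zero_mem_regularSet_of_unitary {R₀ : TowerData P o} (hR : ∀ k ν i, R₀ k ν i ∈ Matrix.unitaryGroup o ℂ)
    (h : ∀ k : Fin (P.K + 1), IsUnit (deltaQT (lev P.L k) (unitMod P) c a (Γ k) (R₀ k) (adjOf (R₀ k))).det) :
    (0 : TowerData P o) ∈ regularSet P c a Γ R₀ :=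
  zero_mem_regularSet_of_isUnit P c a Γ R₀ fun k => by rw [← adjOf_eq_inv (hR k)]; exact h k

/-- [folklore] **A REGULAR CENTRE CARRIES A BALL OF REGULAR CHART POINTS** (openness; the radius is NOT computed here — VECJ-H). -/
theorem exists_ball_subset_regularSet {R₀ : TowerData P o} (h0 : (0 : TowerData P o) ∈ regularSet P c a Γ R₀) :
    ∃ ρ > 0, Metric.ball (0 : TowerData P o) ρ ⊆ regularSet P c a Γ R₀ :=
  Metric.isOpen_iff.1 (isOpen_regularSet P c a Γ R₀) 0 h0

variable {G : Type*} [GaugeGroup G] (ι : G →* Matrix o o ℂ) (av : ∀ j, Averaging P j G)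

/-- [folklore] **THE CENTRE OF RECORD**: for unitary-valued `ι`, the tower data of record `R⁰ := towerDataOf P ι av U` of a configuration
`U` is a regular centre as soon as the operator OF RECORD `deltaQOf` is invertible at every block-averaged background `M^{K−k} U`
(`deltaQOf_eq_deltaQT`; discharged at regular backgrounds by `CovariantVectorGreenOfField.isUnit_det_deltaQOf_of_regular`). -/
theorem zero_mem_regularSet_towerDataOf (hι : ∀ g, ι g ∈ Matrix.unitaryGroup o ℂ) (U : GaugeField P 0 G)
    (h : ∀ k : Fin (P.K + 1), IsUnit (deltaQOf P ι (j := P.K - k) (k := k) (Nat.sub_add_cancel (Nat.le_of_lt_succ k.2)) c a (Γ k)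
      (Averaging.iter av (P.K - k) U)).det) :
    (0 : TowerData P o) ∈ regularSet P c a Γ (towerDataOf P ι av U) :=
  zero_mem_regularSet_of_unitary P c a Γ (fun k ν i => transV_mem_unitaryGroup _ hι _ ν i) fun k => by
    rw [towerDataOf, ← deltaQOf_eq_deltaQT]; exact h k

/-! ## §5 Holomorphy of record along the tower chart -/

variable (s : ℕ → ℂ)

/-- [folklore] **THE LEVEL-`k` TWO-SIDED COVARIANCE ALONG THE TOWER CHART IS ℂ-DIFFERENTIABLE ON THE LEVEL-`k` REGULAR SET** (matrix-valued). -/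
theorem differentiableOn_unitCovT_expChartT (R₀ : TowerData P o) (k : Fin (P.K + 1)) (sc : ℂ) : DifferentiableOn ℂ
    (fun A : TowerData P o => unitCovT (lev P.L k) (unitMod P) c a sc (Γ k) (expChartT P R₀ A k) (expChartInvT P R₀ A k))
    (regularSetAt P c a Γ R₀ k) :=
  differentiableOn_unitCovT (lev P.L k) (unitMod P) (fun ν i => (differentiable_expChartT_apply P R₀ k ν i).differentiableOn)
    (fun ν i => (differentiable_expChartInvT_apply P R₀ k ν i).differentiableOn) (fun _ hA => hA) sc

/-- [folklore] **D-8 (4), THE HOLOMORPHY OF RECORD: EVERY ENTRY OF THE COVARIANCE FAMILY `covAtT` READ ALONG THE TOWER CHART IS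
ℂ-DIFFERENTIABLE ON THE REGULAR SET** — for every level `k` (levels `k > K` read `0`), every slot `t` and every pair of unit-lattice
indices; `DifferentiableOn ℂ` is the notion NE9's `analyticClass` is built from. [Balaban1985BackgroundPropagators] Sect. B ∕ Thm 3.4 and
[Balaban1987RG1] (1.18) are the KIND-level warrant only. -/
theorem differentiableOn_covAtT_expChart (R₀ : TowerData P o) (k : ℕ) {T : Type*} (t : T) (b b' : (Tor (unitMod P) × Fin P.d) × o) :
    DifferentiableOn ℂ (fun A : TowerData P o => covAtT P c a s Γ (expChartT P R₀ A) (expChartInvT P R₀ A) k t b b')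
      (regularSet P c a Γ R₀) := by
  unfold covAtT
  by_cases hk : k ≤ P.K
  · simp only [dif_pos hk]
    exact (differentiableOn_matrix_iff.1
      (differentiableOn_unitCovT_expChartT P c a Γ R₀ ⟨k, Nat.lt_succ_of_le hk⟩ (s k)) b b').mono
      (Set.iInter_subset _ _)
  · simp only [dif_neg hk]
    exact differentiableOn_const _

/-- [folklore] **THE BALL FORM** (what `analyticClass` literally asks): a regular centre has a chart ball `ball 0 ρ` on which every entry
of `covAtT` along the chart is ℂ-differentiable — `ρ` from openness, NOT computed (quantitative radius = VECJ-H on the J-road). -/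
theorem exists_ball_differentiableOn_covAtT {R₀ : TowerData P o} (h0 : (0 : TowerData P o) ∈ regularSet P c a Γ R₀) :
    ∃ ρ > 0, ∀ (k : ℕ) {T : Type*} (t : T) (b b' : (Tor (unitMod P) × Fin P.d) × o),
      DifferentiableOn ℂ (fun A : TowerData P o => covAtT P c a s Γ (expChartT P R₀ A) (expChartInvT P R₀ A) k t b b')
        (Metric.ball (0 : TowerData P o) ρ) := by
  obtain ⟨ρ, hρ, hsub⟩ := exists_ball_subset_regularSet P c a Γ h0
  exact ⟨ρ, hρ, fun k _ t b b' => (differentiableOn_covAtT_expChart P c a Γ s R₀ k t b b').mono hsub⟩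

/-- [folklore] **THE CENTRE READS THE RECORD** (the `hE` of `NE9ChartFamilyPullback`, one chart per real background): for unitary-valued `ι`
the covariance family OF RECORD at `U` is the chart-read two-sided family at the centre `A = 0` of the chart at `R⁰ := towerDataOf P ι av U`
(p220490 `covAtOfRecord_eq_covAtT` + `adjOf_eq_inv`). -/
theorem covAtOfRecord_eq_covAtT_expChartT_zero (hι : ∀ g, ι g ∈ Matrix.unitaryGroup o ℂ) (U : GaugeField P 0 G) (k : ℕ) {T : Type*}
    (t : T) (b b' : (Tor (unitMod P) × Fin P.d) × o) :
    SubstrateRawSpecies.covAtOfRecord P ι av c a s Γ U k t b b' =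
      covAtT P c a s Γ (expChartT P (towerDataOf P ι av U) 0) (expChartInvT P (towerDataOf P ι av U) 0) k t b b' := by
  rw [covAtOfRecord_eq_covAtT, expChartT_zero, expChartInvT_zero]
  have h : (fun k => adjOf (towerDataOf P ι av U k)) = fun k ν i => (towerDataOf P ι av U k ν i)⁻¹ :=
    funext fun k => adjOf_eq_inv fun ν i => transV_mem_unitaryGroup _ hι _ ν i
  rw [h]

end Tower

end Summit.QuantumFields.BalabanUV.T4Continuum.SubstrateTransporterSpeciesHolo

end
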